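import Summits.NavierStokesRegularity.NavierStokesRegularity.Theorems.ExtremiserTransienceNearExtremalTransiencePerFlowOfPorousZone
import Summits.NavierStokesRegularity.NavierStokesRegularity.Theorems.ExtremiserTransienceDepletedFractionCleanLockedWindow
import HarnessLib

/-!
# Crux `NearExtremalTransiencePerFlow` (stmt-NavierStokesRegularity-26567), LINE g12-β «depleted-fraction» (ns-idea-5 g12)

NO SUMMIT IS PROVED BY A LINE.  This is a checked skeleton for the rank-2 crux of route `ExtremiserTransience`; it bears on
LADDER-NS rung «ExtremiserTransience / NearExtremalTransiencePerFlow ⟨26567⟩» and on nothing above it.  The heart X♭ below, the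
crux and NS regularity remain OPEN.

TECHNIQUE CARD «extremal-example mining» (second reading of the same mined fact, typed in its WEAKEST useful form).  The founding
examples of the route (Lu–Doering / Ayala–Protas extreme states, the g11 instrument crystals) say: maximal instantaneous depletion
efficiency is an INSTANT, not a regime.  Line g12-α («transience-exit») typed this as a POINTWISE exit law on a delayed window after a
strictly efficient locked instant (`∀…∃δ ε`, uniform in the flow) and needed a one-sided covering lemma G to turn killed forward
windows into log-measure.  The present line types the DENSITY form, which is (i) weaker as a statement about dynamics — it asks only
that near-extremality have density `< 1` in every admissible turnover window, with no efficiency hypothesis at the window's start and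
no pointwise claim at any later instant — and (ii) cheaper on the flow side: the violator has to supply ONE locked instant with a clean
forward window (a Vitali selection inside the proof of W♭), and the skeleton is a two-line measure comparison.

* **X♭ `DepletedFraction` (HEART, OPEN).**  For classical Leray–Hopf flows from rapidly decaying data on `[0,T) × ℝ³` (any `ν, T`; no
  blow-up, Type-I or violator hypothesis): if the slice `u(t)` has height bound `M`, is Taylor-LOCKED (`Z ≤ Θ(ν/M)²P`), has gradient
  `≤ G M²/ν`, and the heights stay `≤ H M` on the window `I = [t, t + τ₁ν/M²]`, then the set of `ε`-DEPLETED times of `I` — those `t'` at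
  which the flow-wise clause holds with coefficient `κ⋆ − ε` at every height bound — has Lebesgue measure `≥ ε·|I|`.
  Quantifiers `∀ Θ G H τ₁ > 0 ∃ ε > 0 ∀ flows ∀ windows` (second-order transience predicts `ε ≍ τ₁²·c(Θ,G,H)`, `c` = a uniform lower
  bound for the curvature of the efficiency along the flow at its near-maximal values).
* **W♭ `CleanLockedWindow` (flow side, PROVABLE from landed theorems, M/L).**  A violator carries a coefficient `k` with the
  strict-efficiency read-back of p620874 and, for every level `κ⋆/2 ≤ m < κ⋆`, every `η > 0` and every `τ₁ ≤ c_w`, ONE instant `τ` with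
  the X♭-package (height bound `M`, lock `Θ`, gradient `G`, heights `H` on `[τ, τ + τ₁ν/M²] ⊂ [0,T)`) whose forward window is `η`-CLEAN:
  `|{k ≤ m} ∩ [τ, τ + τ₁ν/M²]| ≤ η·τ₁ν/M²`.  Proof plan (card): efficient times have full upper log-density
  (`efficientTimes_logDensity_of_not_perFlow`), locked times lower log-density `d₀` (`lockedTimes_logDensity`), the packages come from
  `lerayLowerRate_of_not_extends` / the Type-I rate / `gradTypeIRate_of_typeIRate` with `M = C√(ν/(T−τ))`, `Θ = c₂C²`, `H = √2`,
  `c_w = C²/2`; if NO locked instant of a long late window had an `η`-clean forward window, a Vitali selection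
  (`Vitali.exists_disjoint_subfamily_covering_enlargement`, windows `[τ, τ + a(T−τ)]`, `a = τ₁/C² ≤ 1/2`, enlargement factor 2 costs
  `log(2/(1−a)) ≤ log 4` of log-measure per selected window) would give `μ_log{k ≤ m} ≥ ηa·(d₀ℓ − B)/log 4` on that window, against the
  violator's `≤ η_v ℓ` with `η_v = ηad₀/(8 log 4)` — contradiction for `ℓ` large.
* **Skeleton** (kernel-checked, ONE theorem concluding the crux BY NAME): violator frame → W♭'s package at `τ` with `η = ε/2` →
  X♭: `ε|I| ≤ |DEPLETED ∩ I|`; read-back: `DEPLETED ⊆ {k ≤ m}` for `m = κ⋆ − min(ε, κ⋆/2)`; W♭: `|{k ≤ m} ∩ I| ≤ (ε/2)|I|` → `|I| ≤ 0`, absurd.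

Levers of the listed lines in five words (as in g12-α): «extremal tangent slice + Liouville» (tangent, constant_speed, two_peak, nodal,
bangbang_core, regularised_transfer), «analytic DSS gap» (analytic_gap), «zone sojourn + descent bounds» (zone_transversality), «filament /
chain / crowding + ledger» (filament_gap, filament_selection, dissipation_ledger, tight_or_chain, multiscale_crowding), «tight + quarter law /
symmetry germ» (leray_pincer, symmetry_harvest), «local maximiser + thick good centre» (local_maximiser), «pointwise exit after efficient
instant + gap covering» (g12-α transience_exit).  Lever here: «near-extremality has density below one per turnover».  HONEST GRADE: same
MECHANISM family as g12-α (dynamic transience) — filed as the alternative, weaker-heart CUT of that mechanism, not as a new mechanism; the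
two skeletons share no stub.

INSTRUMENT ROW: TRANSIENCE (shared with g12-α; prereg `inst/PREREG_transience.md`, job j330755): the density reading is the fraction of
outputs in `[0, 2]` turnovers with `R(τ) ≤ R(0) − 0.02`; booked in `inst/RESULTS_transience.md`.

HONEST FRAMING: X♭ is a conjecture about short-time Navier–Stokes dynamics near the (unknown) maximisers of the depletion quotient; W♭ is a
bookkeeping/covering statement believed provable from the tree; nothing about Navier–Stokes regularity or blow-up is proved here.
[folklore]
-/

noncomputable section

open scoped Topology InnerProductSpace RealInnerProductSpace ENNReal ContDiff
open MeasureTheory Filter Set Metric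
open Literature.Analysis.FluidPDE
open Summit.NavierStokesRegularity.NavierStokesRegularity.Theses.ExtremiserTransience
open Summit.NavierStokesRegularity.NavierStokesRegularity.Theorems
open Summit.NavierStokesRegularity.NavierStokesRegularity.Theorems.DepletionLadder.KStar.HalfSpace
open Summit.NavierStokesRegularity.NavierStokesRegularity.Theorems.NearExtremalTransiencePerFlow.ZoneTransversality

namespace Summit.NavierStokesRegularity.NavierStokesRegularity.Cruxes.NearExtremalTransiencePerFlow.DepletedFraction

-- the summit's namespace repeats the problem name by convention (D-0017)
set_option linter.dupNamespace false
set_option linter.style.longLine false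

/-! ## §1 The two statements -/

/-- **X♭ — DEPLETED FRACTION (HEART, OPEN).**  For classical Leray–Hopf flows from rapidly decaying data on `[0,T) × ℝ³`: after a
Taylor-locked slice with height bound `M`, gradient `≤ G M²/ν` and heights `≤ H M` on `I = [t, t + τ₁ν/M²]`, the `ε`-depleted times
(flow-wise clause with coefficient `κ⋆ − ε` at every height bound) occupy measure `≥ ε|I|` of `I`.  `∀ Θ G H τ₁ > 0 ∃ ε > 0`. -/
def DepletedFraction : Prop :=
  ∀ (Θ G H τ₁ : ℝ), 0 < Θ → 0 < G → 0 < H → 0 < τ₁ → ∃ ε : ℝ, 0 < ε ∧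
    ∀ (ν T : ℝ), 0 < ν → 0 < T →
    ∀ (u : ℝ → EuclideanSpace ℝ (Fin 3) → EuclideanSpace ℝ (Fin 3)) (p : ℝ → EuclideanSpace ℝ (Fin 3) → ℝ),
      IsClassicalNSSolutionOn (Set.Ico 0 T) ν 0 u p → IsLerayHopfOn T ν 0 (u 0) u → HasRapidSpatialDecay (u 0) →
    ∀ (t M : ℝ), 0 ≤ t → 0 < M → t + τ₁ * ν / M ^ 2 < T →
      (∀ x, ‖u t x‖ ≤ M) →
      (∫ x, ‖curl (u t) x‖ ^ 2) ≤ Θ * (ν / M) ^ 2 * (∫ x, frobeniusNormSq (fderiv ℝ (curl (u t)) x)) →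
      (∀ x, ‖fderiv ℝ (u t) x‖ ≤ G * M ^ 2 / ν) →
      (∀ t' ∈ Set.Icc t (t + τ₁ * ν / M ^ 2), ∀ x, ‖u t' x‖ ≤ H * M) →
      ENNReal.ofReal (ε * (τ₁ * ν / M ^ 2)) ≤
        volume ({t' : ℝ | ∀ M' : ℝ, (∀ x, ‖u t' x‖ ≤ M') →
            |∫ x, ⟪curl (u t') x, fderiv ℝ (u t') x (curl (u t') x)⟫_ℝ| ≤
              (kStar - ε) * M' * Real.sqrt (∫ x, ‖curl (u t') x‖ ^ 2) *
                Real.sqrt (∫ x, frobeniusNormSq (fderiv ℝ (curl (u t')) x))} ∩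
          Set.Icc t (t + τ₁ * ν / M ^ 2))

/-- **W♭ — CLEAN LOCKED WINDOW (flow side, PROVABLE from the landed log-density theorems, the rates and a Vitali selection).** -/
def CleanLockedWindow : Prop :=
  ∀ (C ν T : ℝ) (u : ℝ → EuclideanSpace ℝ (Fin 3) → EuclideanSpace ℝ (Fin 3)) (p : ℝ → EuclideanSpace ℝ (Fin 3) → ℝ),
    IsViolator C ν T u p →
    ∃ (k : ℝ → ℝ) (Θ G H c_w : ℝ),
      (∀ t ∈ Set.Ico 0 T, ∀ m : ℝ, 0 ≤ m → m < k t → ∃ M : ℝ, (∀ x, ‖u t x‖ ≤ M) ∧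
        m * M * Real.sqrt (∫ x, ‖curl (u t) x‖ ^ 2) * Real.sqrt (∫ x, frobeniusNormSq (fderiv ℝ (curl (u t)) x)) <
          |∫ x, ⟪curl (u t) x, fderiv ℝ (u t) x (curl (u t) x)⟫_ℝ|) ∧
      0 < Θ ∧ 0 < G ∧ 0 < H ∧ 0 < c_w ∧
      ∀ m : ℝ, kStar / 2 ≤ m → m < kStar → ∀ η : ℝ, 0 < η → ∀ τ₁ : ℝ, 0 < τ₁ → τ₁ ≤ c_w →
        ∃ τ M : ℝ, 0 ≤ τ ∧ 0 < M ∧ τ + τ₁ * ν / M ^ 2 < T ∧ (∀ x, ‖u τ x‖ ≤ M) ∧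
          (∫ x, ‖curl (u τ) x‖ ^ 2) ≤ Θ * (ν / M) ^ 2 * (∫ x, frobeniusNormSq (fderiv ℝ (curl (u τ)) x)) ∧
          (∀ x, ‖fderiv ℝ (u τ) x‖ ≤ G * M ^ 2 / ν) ∧
          (∀ t' ∈ Set.Icc τ (τ + τ₁ * ν / M ^ 2), ∀ x, ‖u t' x‖ ≤ H * M) ∧
          volume ({σ : ℝ | k σ ≤ m} ∩ Set.Icc τ (τ + τ₁ * ν / M ^ 2)) ≤ ENNReal.ofReal (η * (τ₁ * ν / M ^ 2))

/-! ## §2 Registered stubs — rev 2: W♭ is CLOSED by the landed theorem; the ONLY `sorry` of the file is the heart X♭ -/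

/-- HEART (XL, open): depleted fraction of every admissible turnover window. -/
theorem stub_depletedFraction : DepletedFraction := by
  sorry

/-- Flow side (M/L) — ★ LANDED (rev 2): p719836 `cleanLockedWindow_holds` (ns-net-p1 g15; with p719209 `exists_clean_point`), type = the body of
`CleanLockedWindow` VERBATIM. -/
theorem stub_cleanLockedWindow : CleanLockedWindow :=
  Summit.NavierStokesRegularity.NavierStokesRegularity.Theorems.NearExtremalTransiencePerFlow.DepletedFraction.cleanLockedWindow_holds

namespace Registered

/-- registered name of the heart X♭. -/
abbrev stub_depletedFraction : Prop := DepletedFraction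
/-- registered name of the flow-side lemma W♭. -/
abbrev stub_cleanLockedWindow : Prop := CleanLockedWindow

end Registered

/-! ## §3 THE SKELETON: W♭ + X♭ ⇒ the crux BY NAME (no `sorry` outside the two stubs) -/

/-- **LINE g12-β SKELETON.**  Violator frame by contradiction → X♭'s `ε` at W♭'s package constants with `τ₁ = c_w` → level
`m = κ⋆ − min(ε, κ⋆/2)` and cleanliness `η = ε/2` → W♭'s instant `τ` → X♭: `ε|I| ≤ |DEPLETED ∩ I|` → read-back: `DEPLETED ∩ I ⊆ {k ≤ m} ∩ I`
→ `ε|I| ≤ (ε/2)|I|` with `|I| = c_w ν/M² > 0`: absurd. -/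
theorem NearExtremalTransiencePerFlow_of
    (hX : Registered.stub_depletedFraction) :
    NearExtremalTransiencePerFlow := by
  -- rev 2: W♭ is no longer a hypothesis — it is the landed theorem (closed by name above).
  have hW : Registered.stub_cleanLockedWindow := stub_cleanLockedWindow
  intro C ν T hC hν hT u p hsol hLH hdec hrate hsing
  by_contra hno
  have hV : IsViolator C ν T u p := ⟨hC, hν, hT, hsol, hLH, hdec, hrate, hsing, hno⟩
  obtain ⟨k, Θ, G, H, c_w, hkeff, hΘ, hGpos, hH, hcw, hwin⟩ := hW C ν T u p hV
  -- X♭'s deficit/fraction `ε` at window length `τ₁ = c_w`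
  obtain ⟨ε, hε, hX1⟩ := hX Θ G H c_w hΘ hGpos hH hcw
  have hK : 0 < kStar := kStar_pos
  -- the level `m = κ⋆ − e`, `e = min(ε, κ⋆/2)`
  obtain ⟨e, hedef⟩ : ∃ e : ℝ, e = min ε (kStar / 2) := ⟨_, rfl⟩
  have hepos : 0 < e := by rw [hedef]; exact lt_min hε (by linarith)
  have heε : e ≤ ε := by rw [hedef]; exact min_le_left _ _
  have heK : e ≤ kStar / 2 := by rw [hedef]; exact min_le_right _ _
  obtain ⟨m, hmdef⟩ : ∃ m : ℝ, m = kStar - e := ⟨_, rfl⟩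
  have hm_lo : kStar / 2 ≤ m := by linarith
  have hm_lt : m < kStar := by linarith
  have hm0 : 0 ≤ m := by linarith
  have hmε : kStar - ε ≤ m := by linarith
  -- W♭'s clean locked window at cleanliness `η = ε/2`
  have hη : 0 < ε / 2 := by linarith
  obtain ⟨τ, M, hτ0, hM0, hτT, hMb, hlock, hgrad, hheights, hclean⟩ :=
    hwin m hm_lo hm_lt (ε / 2) hη c_w hcw le_rfl
  -- X♭ on that window
  have hfrac := hX1 ν T hν hT u p hsol hLH hdec τ M hτ0 hM0 hτT hMb hlock hgrad hheights
  -- read-back: a depleted time of the window is an inefficient time (`k ≤ m`)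
  have hsub : ({t' : ℝ | ∀ M' : ℝ, (∀ x, ‖u t' x‖ ≤ M') →
        |∫ x, ⟪curl (u t') x, fderiv ℝ (u t') x (curl (u t') x)⟫_ℝ| ≤
          (kStar - ε) * M' * Real.sqrt (∫ x, ‖curl (u t') x‖ ^ 2) *
            Real.sqrt (∫ x, frobeniusNormSq (fderiv ℝ (curl (u t')) x))} ∩
        Set.Icc τ (τ + c_w * ν / M ^ 2)) ⊆
      ({σ : ℝ | k σ ≤ m} ∩ Set.Icc τ (τ + c_w * ν / M ^ 2)) := by
    rintro t' ⟨hdep, ht'I⟩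
    refine ⟨?_, ht'I⟩
    have ht'0 : 0 ≤ t' := hτ0.trans ht'I.1
    have ht'T : t' < T := lt_of_le_of_lt ht'I.2 hτT
    show k t' ≤ m
    by_contra hlt
    push Not at hlt
    obtain ⟨M', hM', hstr⟩ := hkeff t' ⟨ht'0, ht'T⟩ m hm0 hlt
    have hM'0 : 0 ≤ M' := (norm_nonneg _).trans (hM' 0)
    have hle := hdep M' hM'
    have hP' : 0 ≤ M' * Real.sqrt (∫ x, ‖curl (u t') x‖ ^ 2) *
        Real.sqrt (∫ x, frobeniusNormSq (fderiv ℝ (curl (u t')) x)) := by positivity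
    have hmono : (kStar - ε) * M' * Real.sqrt (∫ x, ‖curl (u t') x‖ ^ 2) *
        Real.sqrt (∫ x, frobeniusNormSq (fderiv ℝ (curl (u t')) x)) ≤
        m * M' * Real.sqrt (∫ x, ‖curl (u t') x‖ ^ 2) *
        Real.sqrt (∫ x, frobeniusNormSq (fderiv ℝ (curl (u t')) x)) := by
      have h := mul_le_mul_of_nonneg_right hmε hP'
      calc (kStar - ε) * M' * Real.sqrt (∫ x, ‖curl (u t') x‖ ^ 2) *
            Real.sqrt (∫ x, frobeniusNormSq (fderiv ℝ (curl (u t')) x))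
          = (kStar - ε) * (M' * Real.sqrt (∫ x, ‖curl (u t') x‖ ^ 2) *
            Real.sqrt (∫ x, frobeniusNormSq (fderiv ℝ (curl (u t')) x))) := by ring
        _ ≤ m * (M' * Real.sqrt (∫ x, ‖curl (u t') x‖ ^ 2) *
            Real.sqrt (∫ x, frobeniusNormSq (fderiv ℝ (curl (u t')) x))) := h
        _ = m * M' * Real.sqrt (∫ x, ‖curl (u t') x‖ ^ 2) *
            Real.sqrt (∫ x, frobeniusNormSq (fderiv ℝ (curl (u t')) x)) := by ring
    exact absurd (lt_of_lt_of_le hstr (hle.trans hmono)) (lt_irrefl _)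
  -- measure comparison: `ε|I| ≤ |DEPLETED ∩ I| ≤ |{k ≤ m} ∩ I| ≤ (ε/2)|I|`
  have hcmp : ENNReal.ofReal (ε * (c_w * ν / M ^ 2)) ≤ ENNReal.ofReal (ε / 2 * (c_w * ν / M ^ 2)) :=
    (hfrac.trans (measure_mono hsub)).trans hclean
  have hI : 0 < c_w * ν / M ^ 2 := by positivity
  have hrhs : 0 ≤ ε / 2 * (c_w * ν / M ^ 2) := by positivity
  have hreal : ε * (c_w * ν / M ^ 2) ≤ ε / 2 * (c_w * ν / M ^ 2) := (ENNReal.ofReal_le_ofReal_iff hrhs).1 hcmp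
  nlinarith [hreal, hI, hε]

/-- Sanity: the registered stubs compose to the crux by name. -/
example : NearExtremalTransiencePerFlow :=
  NearExtremalTransiencePerFlow_of stub_depletedFraction

end Summit.NavierStokesRegularity.NavierStokesRegularity.Cruxes.NearExtremalTransiencePerFlow.DepletedFraction

end
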